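import Literature.MathematicalPhysics.QuantumFieldTheory.Balaban1983to89.B9Thm37KLetterDir

/-!
# `Balaban1983to89.B9RWSums346SecondDiffGpDir` — the same-side second-order L² lines (3.46)₃,₅ of Theorem 3.7's sum G′(U) OVER THE DIRECTION LETTERS
# (ruling R1′): n06-k's `B9RWSums346SecondDiffGp.{l2line5_of_local37, l2line3_of_local37, blockBd_second_family5_37, blockBd_second_family3_37}` with `Identities₂`,
# `fixedPoint_dir` and `FactorsL2Second37Dir` — engine re-thread (A3), file 2

T. Bałaban, *Propagators for lattice gauge theories in a background field*, Commun. Math. Phys. **99** (1985) 389–434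
[`Balaban1985BackgroundPropagators`, "B9"], Thm 3.7 (3.87)–(3.90) pp. 408–410, (3.46) p. 398, p. 391; T. Bałaban, *Propagators and renormalization transformations
for lattice gauge theories. II*, Commun. Math. Phys. **96** (1984) 223–250 [`Balaban1984PropagatorsII`, "[4]"], (2.52)–(2.55) p. 232, Lemma 2.1 p. 234.

statement-level skeleton of published theorems with citation tags; proofs where landed; nothing here is a claim about the
Yang–Mills mass gap

WHY THIS FILE (cell `pub-ymgap`, Track A node N06 [B9], rows 18–19; dag-n06-d g10 «re-thread the engine over Identities₂»; seat `pub-ymgap-dag-n06-c` g10).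
The v1 faces use `Identities` only through the fixed point `G′ = G′₀ + G′R′` and the displayed factor schema `FactorsL2Second37` spelled with the v1 K-letter; here the
SAME statements and proofs with `Identities₂`, `hfix := B9Thm37KLetterDir.fixedPoint_dir hi` (`R′ = Σ_□ KopDir·G′_□·M_h`) and `FactorsL2Second37Dir` (the recipe of
`B9RWSums346TwoGpDir`).  Statements, constants (`secondConst`) and every other hypothesis verbatim.

HONEST SCOPE.  Majorant bookkeeping over n06-k's landed L² calculus; Corollary 3.6's L² legs, the factor bounds and (3.88) are HYPOTHESES (schemas); nothing of
[B9] asserted; COUNT-NEUTRAL; N06 NOT discharged; one finite lattice programme — nothing continuum, nothing about OS positivity or the mass gap.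
-/

namespace Literature.MathematicalPhysics.QuantumFieldTheory.Balaban1983to89.B9RWSums346SecondDiffGpDir

open Finset B6RandomWalk B6RandomWalkHom B9Thm37Sum B9Thm34Ext B9Thm37Glue B9Thm37Whole B9Cor38Whole
open B9RWSums343to347Whole B9RWSums346Schur B9Thm37GlueCor36 B9RWSums343Holder B9RWSums343HolderGp B9RWSums346Lap
open B9RWSums344Input B9RWSums344InputGp B9RWSums346Two B9RWSums346TwoGp B11SectG B9Thm37AllNorms B9SectDL2Decay B9RWSums346SecondDiff
open B9RWSums346SecondDiffGp B9Thm37WholeDir B9Thm37KLetterDir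

noncomputable section

section GpSide

variable {g : B9.Geometry} [Fintype g.Site] [DecidableEq g.Site] {R : ℝ} {H : Prop} {B : B9.Backgrounds}
variable {X Y ι P : Type} [Fintype P]

omit [Fintype g.Site] [DecidableEq g.Site] in
/-- Algebra of (3.88) read through an operator on the right. [folklore] -/
private theorem right_split' {Y' : Type} {Dst : (Y' → ℝ) →ₗ[ℝ] (X → ℝ)} {G G0 W : Module.End ℝ (X → ℝ)} (h : G = G0 + G * W) :
    G ∘ₗ Dst = G0 ∘ₗ Dst + G ∘ₗ (W ∘ₗ Dst) := by
  conv_lhs => rw [h]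
  apply LinearMap.ext
  intro μ
  simp only [LinearMap.comp_apply, LinearMap.add_apply, Module.End.mul_apply]

omit [DecidableEq g.Site] in
/-- L² block bounds add. [folklore] -/
private theorem blockBd_add'' [Fintype X] {Z : Type} [Fintype Z] (blk₁ : X → g.Site) (blk₂ : Z → g.Site)
    {T₁ T₂ : (X → ℝ) →ₗ[ℝ] (Z → ℝ)} {K₁ K₂ : g.Site → g.Site → ℝ} (h₁ : BlockBd (g := toB6 g R H) blk₁ blk₂ T₁ K₁)
    (h₂ : BlockBd (g := toB6 g R H) blk₁ blk₂ T₂ K₂) :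
    BlockBd (g := toB6 g R H) blk₁ blk₂ (T₁ + T₂) (fun a b => K₁ a b + K₂ a b) := by
  rw [blockBd_iff_hasMaj] at h₁ h₂ ⊢
  exact h₁.add h₂

/-- ★ **THE SIXTH L² MEMBER OF (3.46) FOR THE SUM G′(U) OF (3.90), PER DIRECTION PAIR** — the L² block bound of G′∇\*_{U,ν}∇\*_{U,μ}: (3.88)
G′ = G′₀ + G′R′ (`fixedPoint_of_388`) read on the right as G′∇\*∇\* = G′₀∇\*∇\* + G′(R′∇\*∇\*); the head legs summed with N₃; the sibling's
Schur block bound C·L₀·(Lʲη)² of G′ (`blockBd_entry0`); the terms of R′∇\*∇\* summed with N′; `comp_l2_transfer` at q = 2.  Bound: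
`secondConst d₁ δ₁ α₁ N₃ B₃ N′ θ₃ C L₀`·e^{−(1−2α)δd(y,y′)} provided 2αδ ≦ δ, (1 − 2α)δ ≦ (1 − α₁)δ₁.
[cite: Balaban1985BackgroundPropagators, Thm 3.7 (3.87)–(3.90) pp.408–410 + (3.46) p.398 + p.391; Balaban1984PropagatorsII, (2.52)–(2.55) p.232 + Lemma 2.1 p.234] -/
theorem l2line5_of_local37_dir [Fintype X] [DecidableEq X] [Fintype ι]
    (𝔬 : Ops g B X Y ι) (𝔡 : DirOps37 𝔬 P) (𝔩 : DirLetters37 𝔬 P) (R : ℝ) (H : Prop) (d d₁ : ℕ) (δ α L₀ δ₁ α₁ ρ N N' Cℓ N3 B3 θ3 C : ℝ) (κ : Sizes)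
    (S3 : ι → Finset g.Site) (U : B.Cfg)
    (hN' : 0 ≤ N') (hN3 : 0 ≤ N3) (hB3 : 0 ≤ B3) (hθ3 : 0 ≤ θ3) (hC : 0 ≤ C)
    (hα2 : 2 * α * δ ≤ δ) (hα₁δ₁ : 0 ≤ α₁ * δ₁) (hrate : (1 - 2 * α) * δ ≤ (1 - α₁) * δ₁)
    (hs : StaticOK 𝔬 ρ N N' Cℓ κ) (hcnt3 : ∀ a : g.Site, (∑ i, if a ∈ S3 i then (1 : ℝ) else 0) ≤ N3)
    (h261 : Ineq261 d₁ (toB6 g R H) δ₁ α₁) (hF : Facts347 g R H d δ α L₀) (hi : Identities₂ 𝔬 𝔡 𝔩 R H U)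
    (hL : L2SecondLegs37 𝔬 𝔡 R H S3 B3 δ₁ U) (hFL : FactorsL2Second37Dir 𝔬 𝔡 𝔩 R H θ3 δ₁ U)
    (h0 : HasMajorant (g := toB6 g R H) 𝔬.blk (𝔬.Gp U) (fun (a b : g.Site) => C * g.len a ^ 2 * Real.exp (-(δ * g.dist a b))))
    (hsym : IsTransposePair (𝔬.Gp U) (𝔬.Gp U)) (ν μ : P) :
    BlockBd (g := toB6 g R H) 𝔬.blk 𝔬.blk (𝔬.Gp U ∘ₗ (𝔡.Dsd U ν ∘ₗ 𝔡.Dsd U μ))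
      (fun (a b : g.Site) => secondConst d₁ δ₁ α₁ N3 B3 N' θ3 C L₀ * Real.exp (-((1 - 2 * α) * δ * g.dist a b))) := by
  have hlen0 : ∀ y : g.Site, 0 ≤ g.len y := fun y => (hs.lenpos y).le
  have htri : Triangle254 (toB6 g R H) := fun a b c => hs.tri a b c
  have hc1 : 0 ≤ B6.c1 d₁ δ₁ α₁ := c1_nonneg d₁ δ₁ α₁
  have hL₀ : 0 ≤ L₀ := le_trans (le_trans zero_le_one hF.one_le_L) hF.L_le
  have hρ'0 : 0 ≤ (1 - 2 * α) * δ := by nlinarith [hα2]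
  have hexp : ∀ a b : g.Site, Real.exp (-(δ₁ * g.dist a b)) ≤ Real.exp (-((1 - 2 * α) * δ * g.dist a b)) := fun a b =>
    Real.exp_le_exp.mpr (neg_le_neg (mul_le_mul_of_nonneg_right (by nlinarith [hrate, hα₁δ₁]) (hs.dnn a b)))
  -- (3.88)
  have hfix : 𝔬.Gp U = (∑ i, mulOp (𝔬.h i) * 𝔬.Gsq U i * mulOp (𝔬.h i)) +
      𝔬.Gp U * ∑ i, KopDir 𝔬 𝔡 𝔩 U i * 𝔬.Gsq U i * mulOp (𝔬.h i) :=
    fixedPoint_dir hi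
  have hsumE : (∑ i, mulOp (𝔬.h i) * 𝔬.Gsq U i * mulOp (𝔬.h i)) ∘ₗ (𝔡.Dsd U ν ∘ₗ 𝔡.Dsd U μ) =
      ∑ i, (mulOp (𝔬.h i) * 𝔬.Gsq U i * mulOp (𝔬.h i)) ∘ₗ (𝔡.Dsd U ν ∘ₗ 𝔡.Dsd U μ) := by
    apply LinearMap.ext
    intro f
    simp only [LinearMap.comp_apply, LinearMap.sum_apply]
  have hsumF : (∑ i, KopDir 𝔬 𝔡 𝔩 U i * 𝔬.Gsq U i * mulOp (𝔬.h i)) ∘ₗ (𝔡.Dsd U ν ∘ₗ 𝔡.Dsd U μ) =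
      ∑ i, (KopDir 𝔬 𝔡 𝔩 U i * 𝔬.Gsq U i * mulOp (𝔬.h i)) ∘ₗ (𝔡.Dsd U ν ∘ₗ 𝔡.Dsd U μ) := by
    apply LinearMap.ext
    intro f
    simp only [LinearMap.comp_apply, LinearMap.sum_apply]
  have hP : BlockBd (g := toB6 g R H) 𝔬.blk 𝔬.blk
      ((∑ i, KopDir 𝔬 𝔡 𝔩 U i * 𝔬.Gsq U i * mulOp (𝔬.h i)) ∘ₗ (𝔡.Dsd U ν ∘ₗ 𝔡.Dsd U μ))
      (fun (y y' : g.Site) => N' * θ3 * g.len y ^ (-(2 : ℝ)) * Real.exp (-(δ₁ * g.dist y y'))) := by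
    rw [hsumF]
    have h := blockBd_localSum (R := R) (H := H) 𝔬.blk 𝔬.blk
      (fun i => (KopDir 𝔬 𝔡 𝔩 U i * 𝔬.Gsq U i * mulOp (𝔬.h i)) ∘ₗ (𝔡.Dsd U ν ∘ₗ 𝔡.Dsd U μ))
      (fun i (y : g.Site) => if y ∈ 𝔬.S' i then (1 : ℝ) else 0)
      (fun (y y' : g.Site) => θ3 * g.len y ^ (-2 : ℝ) * Real.exp (-(δ₁ * g.dist y y'))) N'
      (fun y y' => mul_nonneg (mul_nonneg hθ3 (Real.rpow_nonneg (hlen0 y) _)) (Real.exp_nonneg _))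
      (fun i => hFL.facDD i ν μ) hs.cnt'
    exact h.mono fun y y' => le_of_eq (by ring)
  have hS0 := blockBd_entry0 hF hC hs.symm hs.lenpos 𝔬.blk h0 hsym
  have hS : BlockBd (g := toB6 g R H) 𝔬.blk 𝔬.blk (𝔬.Gp U)
      (fun (a b : g.Site) => C * L₀ * g.len a ^ (2 : ℝ) * Real.exp (-((1 - α) * δ * g.dist a b))) :=
    hS0.mono fun a b => by rw [Real.rpow_two]
  have hρ : (1 - α) * δ = α * δ + (1 - 2 * α) * δ := by ring
  have htail := comp_l2_transfer (R := R) (H := H) 𝔬.blk 𝔬.blk 𝔬.blk hF h261 htri hs.symm hs.dnn hs.lenpos (mul_nonneg hC hL₀)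
    (mul_nonneg hN' hθ3) hρ hρ'0 hrate (by rw [abs_two]; norm_num) hS hP
  have hhead := blockBd_localSum (R := R) (H := H) 𝔬.blk 𝔬.blk
    (fun i => (mulOp (𝔬.h i) * 𝔬.Gsq U i * mulOp (𝔬.h i)) ∘ₗ (𝔡.Dsd U ν ∘ₗ 𝔡.Dsd U μ))
    (fun i (a : g.Site) => if a ∈ S3 i then (1 : ℝ) else 0) (fun (a b : g.Site) => B3 * Real.exp (-(δ₁ * g.dist a b))) N3
    (fun a b => mul_nonneg hB3 (Real.exp_nonneg _)) (fun i => hL.l5 i ν μ) hcnt3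
  rw [right_split' hfix, hsumE]
  refine (blockBd_add'' (R := R) (H := H) 𝔬.blk 𝔬.blk hhead htail).mono fun a b => ?_
  have hK0 : 0 ≤ N3 * B3 := mul_nonneg hN3 hB3
  rw [abs_two]
  calc N3 * (B3 * Real.exp (-(δ₁ * g.dist a b))) +
        C * L₀ * (N' * θ3) * L₀ ^ (2 : ℝ) * B6.c1 d₁ δ₁ α₁ * Real.exp (-((1 - 2 * α) * δ * g.dist a b))
      = N3 * B3 * Real.exp (-(δ₁ * g.dist a b)) +
        C * L₀ * (N' * θ3) * L₀ ^ (2 : ℝ) * B6.c1 d₁ δ₁ α₁ * Real.exp (-((1 - 2 * α) * δ * g.dist a b)) := by ring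
    _ ≤ N3 * B3 * Real.exp (-((1 - 2 * α) * δ * g.dist a b)) +
        C * L₀ * (N' * θ3) * L₀ ^ (2 : ℝ) * B6.c1 d₁ δ₁ α₁ * Real.exp (-((1 - 2 * α) * δ * g.dist a b)) :=
        add_le_add (mul_le_mul_of_nonneg_left (hexp a b) hK0) le_rfl
    _ = secondConst d₁ δ₁ α₁ N3 B3 N' θ3 C L₀ * Real.exp (-((1 - 2 * α) * δ * g.dist a b)) := by
        unfold secondConst; ring

/-- ★ **THE FOURTH L² MEMBER OF (3.46) FOR THE SUM G′(U), PER DIRECTION PAIR, BY ADJOINT TRANSFER** — ∇_ν∇_μG′ = (G′∇\*_μ∇\*_ν)ᵀ (G′ symmetric,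
∇\*_κ = ∇_κᵀ), `B9SectDL2Decay.blockBd_of_adjoint`. [cite: Balaban1985BackgroundPropagators, (3.46) p.398 (fourth member) + p.398 ll.28–31 + p.391] -/
theorem l2line3_of_local37_dir [Fintype X] [DecidableEq X] [Fintype ι]
    (𝔬 : Ops g B X Y ι) (𝔡 : DirOps37 𝔬 P) (𝔩 : DirLetters37 𝔬 P) (R : ℝ) (H : Prop) (d d₁ : ℕ) (δ α L₀ δ₁ α₁ ρ N N' Cℓ N3 B3 θ3 C : ℝ) (κ : Sizes)
    (S3 : ι → Finset g.Site) (U : B.Cfg)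
    (hN' : 0 ≤ N') (hN3 : 0 ≤ N3) (hB3 : 0 ≤ B3) (hθ3 : 0 ≤ θ3) (hC : 0 ≤ C)
    (hα2 : 2 * α * δ ≤ δ) (hα₁δ₁ : 0 ≤ α₁ * δ₁) (hrate : (1 - 2 * α) * δ ≤ (1 - α₁) * δ₁)
    (hs : StaticOK 𝔬 ρ N N' Cℓ κ) (hcnt3 : ∀ a : g.Site, (∑ i, if a ∈ S3 i then (1 : ℝ) else 0) ≤ N3)
    (h261 : Ineq261 d₁ (toB6 g R H) δ₁ α₁) (hF : Facts347 g R H d δ α L₀) (hi : Identities₂ 𝔬 𝔡 𝔩 R H U)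
    (hL : L2SecondLegs37 𝔬 𝔡 R H S3 B3 δ₁ U) (hFL : FactorsL2Second37Dir 𝔬 𝔡 𝔩 R H θ3 δ₁ U) (hDT : DirTranspose37 𝔬 𝔡 U)
    (h0 : HasMajorant (g := toB6 g R H) 𝔬.blk (𝔬.Gp U) (fun (a b : g.Site) => C * g.len a ^ 2 * Real.exp (-(δ * g.dist a b))))
    (hsym : IsTransposePair (𝔬.Gp U) (𝔬.Gp U)) (ν μ : P) :
    BlockBd (g := toB6 g R H) 𝔬.blk 𝔬.blk ((𝔡.Dd U ν ∘ₗ 𝔡.Dd U μ) ∘ₗ 𝔬.Gp U)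
      (fun (a b : g.Site) => secondConst d₁ δ₁ α₁ N3 B3 N' θ3 C L₀ * Real.exp (-((1 - 2 * α) * δ * g.dist a b))) := by
  have h5 := l2line5_of_local37_dir 𝔬 𝔡 𝔩 R H d d₁ δ α L₀ δ₁ α₁ ρ N N' Cℓ N3 B3 θ3 C κ S3 U hN' hN3 hB3 hθ3 hC hα2 hα₁δ₁ hrate hs
    hcnt3 h261 hF hi hL hFL h0 hsym μ ν
  have hL₀ : 0 ≤ L₀ := le_trans (le_trans zero_le_one hF.one_le_L) hF.L_le
  have hK : 0 ≤ secondConst d₁ δ₁ α₁ N3 B3 N' θ3 C L₀ := secondConst_nonneg hN3 hB3 hN' hθ3 hC hL₀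
  have hadj : IsTransposePair (𝔬.Gp U ∘ₗ (𝔡.Dsd U μ ∘ₗ 𝔡.Dsd U ν)) ((𝔡.Dd U ν ∘ₗ 𝔡.Dd U μ) ∘ₗ 𝔬.Gp U) :=
    ((hDT.tr ν).comp (hDT.tr μ)).comp hsym
  have h := blockBd_of_adjoint (g := toB6 g R H) (blk₁ := 𝔬.blk) (blk₂ := 𝔬.blk) (T := (𝔡.Dd U ν ∘ₗ 𝔡.Dd U μ) ∘ₗ 𝔬.Gp U)
    (T' := 𝔬.Gp U ∘ₗ (𝔡.Dsd U μ ∘ₗ 𝔡.Dsd U ν)) (fun u w => by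
      rw [dotProduct, dotProduct]
      exact (hadj u w).symm) h5 (fun y y' => mul_nonneg hK (Real.exp_nonneg _))
  refine h.mono fun y y' => ?_
  rw [hs.symm y' y]


/-- ★ **THE PACKAGED FAMILY G′∇\*_{U,ν}∇\*_{U,μ} OVER (ν, μ) ∈ P × P** has the L² block bound |P|·`secondConst …`·e^{−(1−2α)δd} between the fibres
of `blk` and `blk ∘ fst`. [cite: Balaban1985BackgroundPropagators, (3.46) p.398 + (3.39) p.397] -/
theorem blockBd_second_family5_37_dir [Fintype X] [DecidableEq X] [Fintype ι]
    (𝔬 : Ops g B X Y ι) (𝔡 : DirOps37 𝔬 P) (𝔩 : DirLetters37 𝔬 P) (R : ℝ) (H : Prop) (d d₁ : ℕ) (δ α L₀ δ₁ α₁ ρ N N' Cℓ N3 B3 θ3 C : ℝ) (κ : Sizes)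
    (S3 : ι → Finset g.Site) (U : B.Cfg)
    (hN' : 0 ≤ N') (hN3 : 0 ≤ N3) (hB3 : 0 ≤ B3) (hθ3 : 0 ≤ θ3) (hC : 0 ≤ C)
    (hα2 : 2 * α * δ ≤ δ) (hα₁δ₁ : 0 ≤ α₁ * δ₁) (hrate : (1 - 2 * α) * δ ≤ (1 - α₁) * δ₁)
    (hs : StaticOK 𝔬 ρ N N' Cℓ κ) (hcnt3 : ∀ a : g.Site, (∑ i, if a ∈ S3 i then (1 : ℝ) else 0) ≤ N3)
    (h261 : Ineq261 d₁ (toB6 g R H) δ₁ α₁) (hF : Facts347 g R H d δ α L₀) (hi : Identities₂ 𝔬 𝔡 𝔩 R H U)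
    (hL : L2SecondLegs37 𝔬 𝔡 R H S3 B3 δ₁ U) (hFL : FactorsL2Second37Dir 𝔬 𝔡 𝔩 R H θ3 δ₁ U)
    (h0 : HasMajorant (g := toB6 g R H) 𝔬.blk (𝔬.Gp U) (fun (a b : g.Site) => C * g.len a ^ 2 * Real.exp (-(δ * g.dist a b))))
    (hsym : IsTransposePair (𝔬.Gp U) (𝔬.Gp U)) :
    BlockBd (g := toB6 g R H) 𝔬.blk (𝔬.blk ∘ Prod.fst)
      (familyOp fun p : P × P => 𝔬.Gp U ∘ₗ (𝔡.Dsd U p.1 ∘ₗ 𝔡.Dsd U p.2))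
      (fun (a b : g.Site) => (Fintype.card P : ℝ) * secondConst d₁ δ₁ α₁ N3 B3 N' θ3 C L₀ *
        Real.exp (-((1 - 2 * α) * δ * g.dist a b))) := by
  have hL₀ : 0 ≤ L₀ := le_trans (le_trans zero_le_one hF.one_le_L) hF.L_le
  have hK : 0 ≤ secondConst d₁ δ₁ α₁ N3 B3 N' θ3 C L₀ := secondConst_nonneg hN3 hB3 hN' hθ3 hC hL₀
  have h := blockBd_familyOp (R := R) (H := H) 𝔬.blk 𝔬.blk (P := P × P)
    (T := fun p : P × P => 𝔬.Gp U ∘ₗ (𝔡.Dsd U p.1 ∘ₗ 𝔡.Dsd U p.2))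
    (fun a b => mul_nonneg hK (Real.exp_nonneg _))
    (fun p => l2line5_of_local37_dir 𝔬 𝔡 𝔩 R H d d₁ δ α L₀ δ₁ α₁ ρ N N' Cℓ N3 B3 θ3 C κ S3 U hN' hN3 hB3 hθ3 hC hα2 hα₁δ₁ hrate hs
      hcnt3 h261 hF hi hL hFL h0 hsym p.1 p.2)
  refine h.mono fun a b => le_of_eq ?_
  rw [Fintype.card_prod, Nat.cast_mul, Real.sqrt_mul_self (Nat.cast_nonneg _)]
  ring

/-- ★ **THE PACKAGED FAMILY ∇_{U,ν}∇_{U,μ}G′ OVER (ν, μ) ∈ P × P** has the L² block bound |P|·`secondConst …`·e^{−(1−2α)δd}.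
[cite: Balaban1985BackgroundPropagators, (3.46) p.398 + (3.39) p.397] -/
theorem blockBd_second_family3_37_dir [Fintype X] [DecidableEq X] [Fintype ι]
    (𝔬 : Ops g B X Y ι) (𝔡 : DirOps37 𝔬 P) (𝔩 : DirLetters37 𝔬 P) (R : ℝ) (H : Prop) (d d₁ : ℕ) (δ α L₀ δ₁ α₁ ρ N N' Cℓ N3 B3 θ3 C : ℝ) (κ : Sizes)
    (S3 : ι → Finset g.Site) (U : B.Cfg)
    (hN' : 0 ≤ N') (hN3 : 0 ≤ N3) (hB3 : 0 ≤ B3) (hθ3 : 0 ≤ θ3) (hC : 0 ≤ C)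
    (hα2 : 2 * α * δ ≤ δ) (hα₁δ₁ : 0 ≤ α₁ * δ₁) (hrate : (1 - 2 * α) * δ ≤ (1 - α₁) * δ₁)
    (hs : StaticOK 𝔬 ρ N N' Cℓ κ) (hcnt3 : ∀ a : g.Site, (∑ i, if a ∈ S3 i then (1 : ℝ) else 0) ≤ N3)
    (h261 : Ineq261 d₁ (toB6 g R H) δ₁ α₁) (hF : Facts347 g R H d δ α L₀) (hi : Identities₂ 𝔬 𝔡 𝔩 R H U)
    (hL : L2SecondLegs37 𝔬 𝔡 R H S3 B3 δ₁ U) (hFL : FactorsL2Second37Dir 𝔬 𝔡 𝔩 R H θ3 δ₁ U) (hDT : DirTranspose37 𝔬 𝔡 U)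
    (h0 : HasMajorant (g := toB6 g R H) 𝔬.blk (𝔬.Gp U) (fun (a b : g.Site) => C * g.len a ^ 2 * Real.exp (-(δ * g.dist a b))))
    (hsym : IsTransposePair (𝔬.Gp U) (𝔬.Gp U)) :
    BlockBd (g := toB6 g R H) 𝔬.blk (𝔬.blk ∘ Prod.fst)
      (familyOp fun p : P × P => (𝔡.Dd U p.1 ∘ₗ 𝔡.Dd U p.2) ∘ₗ 𝔬.Gp U)
      (fun (a b : g.Site) => (Fintype.card P : ℝ) * secondConst d₁ δ₁ α₁ N3 B3 N' θ3 C L₀ *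
        Real.exp (-((1 - 2 * α) * δ * g.dist a b))) := by
  have hL₀ : 0 ≤ L₀ := le_trans (le_trans zero_le_one hF.one_le_L) hF.L_le
  have hK : 0 ≤ secondConst d₁ δ₁ α₁ N3 B3 N' θ3 C L₀ := secondConst_nonneg hN3 hB3 hN' hθ3 hC hL₀
  have h := blockBd_familyOp (R := R) (H := H) 𝔬.blk 𝔬.blk (P := P × P)
    (T := fun p : P × P => (𝔡.Dd U p.1 ∘ₗ 𝔡.Dd U p.2) ∘ₗ 𝔬.Gp U)
    (fun a b => mul_nonneg hK (Real.exp_nonneg _))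
    (fun p => l2line3_of_local37_dir 𝔬 𝔡 𝔩 R H d d₁ δ α L₀ δ₁ α₁ ρ N N' Cℓ N3 B3 θ3 C κ S3 U hN' hN3 hB3 hθ3 hC hα2 hα₁δ₁ hrate hs
      hcnt3 h261 hF hi hL hFL hDT h0 hsym p.1 p.2)
  refine h.mono fun a b => le_of_eq ?_
  rw [Fintype.card_prod, Nat.cast_mul, Real.sqrt_mul_self (Nat.cast_nonneg _)]
  ring

end GpSide

end

end Literature.MathematicalPhysics.QuantumFieldTheory.Balaban1983to89.B9RWSums346SecondDiffGpDir
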